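import Literature.Analysis.SpecialFunctions.SelbergIntegral
import Mathlib.Probability.Distributions.Beta
import Mathlib.MeasureTheory.Integral.Pi
import Mathlib.MeasureTheory.Constructions.Pi
import Mathlib.Analysis.SpecialFunctions.Pow.Continuity
import HarnessLib

/-!
# The Selberg integral: basic properties of the integrand

Infrastructure for the proof of Selberg's integral formula
(`Literature.Analysis.SpecialFunctions.selberg_integral_formula`), following the architecture of
Aomoto's proof as presented in G. E. Andrews, R. Askey, R. Roy, *Special Functions* (1999), §8.2,
and P. J. Forrester, S. O. Warnaar, *The importance of the Selberg integral*, Bull. AMS 45 (2008),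
(1.1)–(1.3).

Contents: the Selberg weight `Selberg.weight n a b c t = ∏ᵢ tᵢ^{a-1}(1-tᵢ)^{b-1} ∏_{i<j}|tᵢ-tⱼ|^{2c}`
as a named function, its manifestly symmetric form (the pair product written as
`∏ᵢ ∏_{j ≠ i} |tᵢ - tⱼ|^{c}`), nonnegativity, measurability, continuity in the regime
`a, b ≥ 1, c ≥ 0`, the unit cube and its measure, and the one–variable case `S₁(a,b,c) = B(a,b)`
(Euler's Beta integral, FW (1.3)).

All results here are fully proved; nothing is stated as a named fact.
-/

noncomputable section

open MeasureTheory Real Finset Set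

namespace Literature.Analysis.SpecialFunctions

namespace Selberg

/-- The closed unit cube `[0,1]^n ⊂ (Fin n → ℝ)`, the domain of the Selberg integral. [folklore] -/
def cube (n : ℕ) : Set (Fin n → ℝ) := Set.pi Set.univ fun _ : Fin n => Set.Icc (0 : ℝ) 1

/-- The one-body part `∏ᵢ tᵢ^{a-1} (1 - tᵢ)^{b-1}` of the Selberg weight. [folklore] -/
def body (n : ℕ) (a b : ℝ) (t : Fin n → ℝ) : ℝ := ∏ i : Fin n, t i ^ (a - 1) * (1 - t i) ^ (b - 1)

/-- The two-body part `∏_{i<j} |tᵢ - tⱼ|^{2c}` of the Selberg weight, as printed.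
[cite: ForresterWarnaar2008, eq. (1.1)] -/
def pairLT (n : ℕ) (c : ℝ) (t : Fin n → ℝ) : ℝ :=
  ∏ i : Fin n, ∏ j ∈ univ.filter (fun j : Fin n => i < j), |t i - t j| ^ (2 * c)

/-- The two-body part in manifestly symmetric form `∏ᵢ ∏_{j ≠ i} |tᵢ - tⱼ|^{c}` (each unordered
pair counted twice, with exponent `c` each time). [folklore] -/
def pairSym (n : ℕ) (c : ℝ) (t : Fin n → ℝ) : ℝ :=
  ∏ i : Fin n, ∏ j : Fin n, if i = j then 1 else |t i - t j| ^ c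

/-- The Selberg weight `∏ᵢ tᵢ^{a-1}(1-tᵢ)^{b-1} ∏_{i<j} |tᵢ - tⱼ|^{2c}`, the integrand of
`selbergIntegral`. [cite: ForresterWarnaar2008, eq. (1.1)] -/
def weight (n : ℕ) (a b c : ℝ) (t : Fin n → ℝ) : ℝ := body n a b t * pairLT n c t

/-- `selbergIntegral` is the integral of `Selberg.weight` over the cube. [folklore] -/
theorem selbergIntegral_eq_integral_weight (n : ℕ) (a b c : ℝ) :
    selbergIntegral n a b c = ∫ t in cube n, weight n a b c t := rfl

/-! ### The symmetric form of the pair product -/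

/-- `|x|^c · |x|^c = |x|^{2c}` (all real `c`). [folklore] -/
theorem abs_rpow_mul_self (x c : ℝ) : |x| ^ c * |x| ^ c = |x| ^ (2 * c) := by
  rcases eq_or_ne c 0 with rfl | hc
  · simp
  · rw [← Real.rpow_add' (abs_nonneg x) (by contrapose! hc; linarith), ← two_mul]

/-- The symmetric pair product equals the printed one: `∏ᵢ ∏_{j≠i} |tᵢ-tⱼ|^c = ∏_{i<j} |tᵢ-tⱼ|^{2c}`.
[folklore] -/
theorem pairSym_eq_pairLT (n : ℕ) (c : ℝ) (t : Fin n → ℝ) : pairSym n c t = pairLT n c t := by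
  classical
  unfold pairSym pairLT
  -- split `j ≠ i` into `i < j` and `j < i`
  have hsplit : ∀ i : Fin n, (∏ j : Fin n, if i = j then (1 : ℝ) else |t i - t j| ^ c) =
      (∏ j ∈ univ.filter (fun j : Fin n => i < j), |t i - t j| ^ c) *
        ∏ j ∈ univ.filter (fun j : Fin n => j < i), |t i - t j| ^ c := by
    intro i
    rw [prod_ite, prod_const_one, one_mul]
    have hu : univ.filter (fun j : Fin n => ¬ i = j) =
        univ.filter (fun j : Fin n => i < j) ∪ univ.filter (fun j : Fin n => j < i) := by
      ext j
      simp only [Finset.mem_filter, Finset.mem_univ, true_and, Finset.mem_union]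
      exact ⟨fun h => lt_or_gt_of_ne h, fun h => h.elim ne_of_lt fun h' => (ne_of_lt h').symm⟩
    rw [hu, Finset.prod_union (Finset.disjoint_filter.2 fun j _ hij hji => lt_asymm hij hji)]
  simp_rw [hsplit]
  rw [prod_mul_distrib]
  -- the second factor equals the first one after exchanging the order of the two products
  have hcomm : (∏ i : Fin n, ∏ j ∈ univ.filter (fun j : Fin n => j < i), |t i - t j| ^ c) =
      ∏ j : Fin n, ∏ i ∈ univ.filter (fun i : Fin n => j < i), |t i - t j| ^ c := by
    apply prod_comm'
    intro i j
    simp only [Finset.mem_filter, Finset.mem_univ, true_and, and_true]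
  rw [hcomm, ← prod_mul_distrib]
  refine prod_congr rfl fun i _ => ?_
  rw [← prod_mul_distrib]
  refine prod_congr rfl fun j _ => ?_
  rw [abs_sub_comm (t j) (t i), abs_rpow_mul_self]

/-- The Selberg weight with its pair factor in symmetric form. [folklore] -/
theorem weight_eq_body_mul_pairSym (n : ℕ) (a b c : ℝ) (t : Fin n → ℝ) :
    weight n a b c t = body n a b t * pairSym n c t := by
  rw [weight, pairSym_eq_pairLT]

/-! ### Nonnegativity -/

/-- The one-body factor is nonnegative on the cube. [folklore] -/
theorem body_nonneg {n : ℕ} (a b : ℝ) {t : Fin n → ℝ} (ht : t ∈ cube n) : 0 ≤ body n a b t := by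
  refine prod_nonneg fun i _ => ?_
  have h := ht i (Set.mem_univ i)
  exact mul_nonneg (rpow_nonneg h.1 _) (rpow_nonneg (by linarith [h.2]) _)

/-- The symmetric pair factor is nonnegative. [folklore] -/
theorem pairSym_nonneg (n : ℕ) (c : ℝ) (t : Fin n → ℝ) : 0 ≤ pairSym n c t := by
  refine prod_nonneg fun i _ => prod_nonneg fun j _ => ?_
  split_ifs
  · exact zero_le_one
  · exact rpow_nonneg (abs_nonneg _) _

/-- The pair factor is nonnegative. [folklore] -/
theorem pairLT_nonneg (n : ℕ) (c : ℝ) (t : Fin n → ℝ) : 0 ≤ pairLT n c t := by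
  rw [← pairSym_eq_pairLT]; exact pairSym_nonneg n c t

/-- The Selberg weight is nonnegative on the cube. [folklore] -/
theorem weight_nonneg {n : ℕ} (a b c : ℝ) {t : Fin n → ℝ} (ht : t ∈ cube n) :
    0 ≤ weight n a b c t :=
  mul_nonneg (body_nonneg a b ht) (pairLT_nonneg n c t)

/-! ### The cube -/

/-- The cube is measurable. [folklore] -/
theorem measurableSet_cube (n : ℕ) : MeasurableSet (cube n) :=
  MeasurableSet.univ_pi fun _ => measurableSet_Icc

/-- The cube is compact. [folklore] -/
theorem isCompact_cube (n : ℕ) : IsCompact (cube n) :=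
  isCompact_univ_pi fun _ => isCompact_Icc

/-- The cube has Lebesgue measure `1`. [folklore] -/
theorem volume_cube (n : ℕ) : volume (cube n) = 1 := by
  rw [cube, volume_pi_pi]
  simp

/-- Membership in the cube, coordinatewise. [folklore] -/
theorem mem_cube_iff {n : ℕ} (t : Fin n → ℝ) : t ∈ cube n ↔ ∀ i, 0 ≤ t i ∧ t i ≤ 1 := by
  simp only [cube, Set.mem_univ_pi, Set.mem_Icc]

/-! ### Measurability and continuity -/

/-- The one-body factor is measurable. [folklore] -/
@[fun_prop]
theorem measurable_body (n : ℕ) (a b : ℝ) : Measurable (body n a b) := by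
  unfold body
  refine Finset.measurable_prod _ fun i _ => ?_
  fun_prop

/-- The symmetric pair factor is measurable. [folklore] -/
@[fun_prop]
theorem measurable_pairSym (n : ℕ) (c : ℝ) : Measurable (pairSym n c) := by
  unfold pairSym
  refine Finset.measurable_prod _ fun i _ => Finset.measurable_prod _ fun j _ => ?_
  split_ifs
  · exact measurable_const
  · fun_prop

/-- The pair factor is measurable. [folklore] -/
@[fun_prop]
theorem measurable_pairLT (n : ℕ) (c : ℝ) : Measurable (pairLT n c) := by
  have : pairLT n c = pairSym n c := funext fun t => (pairSym_eq_pairLT n c t).symm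
  rw [this]; exact measurable_pairSym n c

/-- The Selberg weight is measurable. [folklore] -/
@[fun_prop]
theorem measurable_weight (n : ℕ) (a b c : ℝ) : Measurable (weight n a b c) := by
  unfold weight; fun_prop

/-- For `a, b ≥ 1` the one-body factor is continuous. [folklore] -/
theorem continuous_body {n : ℕ} {a b : ℝ} (ha : 1 ≤ a) (hb : 1 ≤ b) : Continuous (body n a b) := by
  unfold body
  refine continuous_finsetProd _ fun i _ => ?_
  refine Continuous.mul ?_ ?_
  · exact Continuous.rpow_const (by fun_prop) fun _ => Or.inr (by linarith)
  · exact Continuous.rpow_const (by fun_prop) fun _ => Or.inr (by linarith)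

/-- For `c ≥ 0` the symmetric pair factor is continuous. [folklore] -/
theorem continuous_pairSym {n : ℕ} {c : ℝ} (hc : 0 ≤ c) : Continuous (pairSym n c) := by
  unfold pairSym
  refine continuous_finsetProd _ fun i _ => continuous_finsetProd _ fun j _ => ?_
  split_ifs
  · exact continuous_const
  · exact Continuous.rpow_const (by fun_prop) fun _ => Or.inr hc

/-- For `a, b ≥ 1`, `c ≥ 0` the Selberg weight is continuous. [folklore] -/
theorem continuous_weight {n : ℕ} {a b c : ℝ} (ha : 1 ≤ a) (hb : 1 ≤ b) (hc : 0 ≤ c) :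
    Continuous (weight n a b c) := by
  have : weight n a b c = fun t => body n a b t * pairSym n c t :=
    funext fun t => weight_eq_body_mul_pairSym n a b c t
  rw [this]
  exact (continuous_body ha hb).mul (continuous_pairSym hc)

/-! ### Bounds on the cube -/

/-- On the cube the symmetric pair factor is at most `1` when `c ≥ 0`. [folklore] -/
theorem pairSym_le_one {n : ℕ} {c : ℝ} (hc : 0 ≤ c) {t : Fin n → ℝ} (ht : t ∈ cube n) :
    pairSym n c t ≤ 1 := by
  rw [mem_cube_iff] at ht
  refine prod_le_one (fun i _ => prod_nonneg fun j _ => ?_) fun i _ => ?_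
  · split_ifs
    · exact zero_le_one
    · exact rpow_nonneg (abs_nonneg _) _
  · refine prod_le_one (fun j _ => ?_) fun j _ => ?_
    · split_ifs
      · exact zero_le_one
      · exact rpow_nonneg (abs_nonneg _) _
    · split_ifs
      · exact le_rfl
      · refine rpow_le_one (abs_nonneg _) ?_ hc
        have hi := ht i
        have hj := ht j
        rw [abs_le]
        constructor <;> linarith

/-- On the cube the Selberg weight is dominated by its one-body factor when `c ≥ 0`.
[folklore] -/
theorem weight_le_body {n : ℕ} (a b : ℝ) {c : ℝ} (hc : 0 ≤ c) {t : Fin n → ℝ} (ht : t ∈ cube n) :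
    weight n a b c t ≤ body n a b t := by
  rw [weight_eq_body_mul_pairSym]
  exact mul_le_of_le_one_right (body_nonneg a b ht) (pairSym_le_one hc ht)

/-! ### The one-variable case: Euler's Beta integral (FW (1.3)) -/

/-- Euler's Beta integral on `(0,1)`: integrability and value `Γ(a)Γ(b)/Γ(a+b)` for `a, b > 0`
(read off from Mathlib's normalised Beta density `ProbabilityTheory.lintegral_betaPDF_eq_one`).
[cite: ForresterWarnaar2008, eq. (1.3)] -/
theorem integrableOn_Ioo_rpow_mul_one_sub_rpow_and_integral_eq {a b : ℝ} (ha : 0 < a) (hb : 0 < b) :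
    IntegrableOn (fun x : ℝ => x ^ (a - 1) * (1 - x) ^ (b - 1)) (Ioo 0 1) ∧
      ∫ x in Ioo (0 : ℝ) 1, x ^ (a - 1) * (1 - x) ^ (b - 1) =
        Gamma a * Gamma b / Gamma (a + b) := by
  have hc0 : 0 < ProbabilityTheory.beta a b := ProbabilityTheory.beta_pos ha hb
  set g : ℝ → ℝ := fun x => 1 / ProbabilityTheory.beta a b * x ^ (a - 1) * (1 - x) ^ (b - 1)
    with hg
  have hlin : ∫⁻ x in Ioo (0 : ℝ) 1, ENNReal.ofReal (g x) = 1 := by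
    rw [hg, ← ProbabilityTheory.lintegral_betaPDF, ProbabilityTheory.lintegral_betaPDF_eq_one ha hb]
  have hg0 : 0 ≤ᵐ[volume.restrict (Ioo (0 : ℝ) 1)] g := by
    refine ae_restrict_of_forall_mem measurableSet_Ioo fun x hx => ?_
    have h1 : 0 ≤ x ^ (a - 1) := rpow_nonneg hx.1.le _
    have h2 : 0 ≤ (1 - x) ^ (b - 1) := rpow_nonneg (by linarith [hx.2]) _
    simp only [hg, Pi.zero_apply]
    exact mul_nonneg (mul_nonneg (by positivity) h1) h2
  have hgm : AEStronglyMeasurable g (volume.restrict (Ioo (0 : ℝ) 1)) :=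
    Measurable.aestronglyMeasurable (by fun_prop)
  have hgi : Integrable g (volume.restrict (Ioo (0 : ℝ) 1)) :=
    ⟨hgm, (hasFiniteIntegral_iff_ofReal hg0).2 (by simp [hlin])⟩
  have hgint : ∫ x in Ioo (0 : ℝ) 1, g x = 1 := by
    rw [integral_eq_lintegral_of_nonneg_ae hg0 hgm, hlin]; simp
  have hfg : (fun x : ℝ => x ^ (a - 1) * (1 - x) ^ (b - 1)) =
      fun x => ProbabilityTheory.beta a b * g x := by
    funext x
    simp only [hg]
    field_simp
  refine ⟨?_, ?_⟩
  · rw [hfg]; exact hgi.const_mul _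
  · rw [hfg, integral_const_mul, hgint, mul_one, ProbabilityTheory.beta]

/-- The Beta integrand is integrable on `[0,1]` for `a, b > 0`. [folklore] -/
theorem integrableOn_Icc_rpow_mul_one_sub_rpow {a b : ℝ} (ha : 0 < a) (hb : 0 < b) :
    IntegrableOn (fun x : ℝ => x ^ (a - 1) * (1 - x) ^ (b - 1)) (Icc 0 1) := by
  rw [integrableOn_Icc_iff_integrableOn_Ioo]
  exact (integrableOn_Ioo_rpow_mul_one_sub_rpow_and_integral_eq ha hb).1

/-- Euler's Beta integral on the closed unit interval. [cite: ForresterWarnaar2008, eq. (1.3)] -/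
theorem integral_Icc_rpow_mul_one_sub_rpow {a b : ℝ} (ha : 0 < a) (hb : 0 < b) :
    ∫ x in Icc (0 : ℝ) 1, x ^ (a - 1) * (1 - x) ^ (b - 1) = Gamma a * Gamma b / Gamma (a + b) := by
  rw [integral_Icc_eq_integral_Ioo]
  exact (integrableOn_Ioo_rpow_mul_one_sub_rpow_and_integral_eq ha hb).2

/-- In one variable the pair factor is `1`. [folklore] -/
theorem pairLT_one (c : ℝ) (t : Fin 1 → ℝ) : pairLT 1 c t = 1 := by
  unfold pairLT
  rw [Fin.prod_univ_one]
  have : univ.filter (fun j : Fin 1 => (0 : Fin 1) < j) = ∅ := by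
    ext j
    simp [Subsingleton.elim j 0]
  rw [this, Finset.prod_empty]

/-- In one variable the Selberg weight is the Beta integrand. [folklore] -/
theorem weight_one (a b c : ℝ) (t : Fin 1 → ℝ) :
    weight 1 a b c t = t 0 ^ (a - 1) * (1 - t 0) ^ (b - 1) := by
  rw [weight, pairLT_one, mul_one, body, Fin.prod_univ_one]

/-- The cube in `Fin 1 → ℝ` is the preimage of `[0,1]` under evaluation. [folklore] -/
theorem cube_one_eq_preimage :
    cube 1 = (MeasurableEquiv.funUnique (Fin 1) ℝ) ⁻¹' Icc (0 : ℝ) 1 := by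
  ext t
  rw [mem_cube_iff, Fin.forall_fin_one, Set.mem_preimage, Set.mem_Icc]
  exact Iff.rfl

/-- **`S₁(a, b, c) = Γ(a)Γ(b)/Γ(a+b)`** for `a, b > 0` (any `c`): the Selberg integral in one
variable is Euler's Beta integral. [cite: ForresterWarnaar2008, eq. (1.3)] -/
theorem selbergIntegral_one_eq {a b : ℝ} (c : ℝ) (ha : 0 < a) (hb : 0 < b) :
    selbergIntegral 1 a b c = Gamma a * Gamma b / Gamma (a + b) := by
  have h := (volume_preserving_funUnique (Fin 1) ℝ).setIntegral_preimage_emb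
      (MeasurableEquiv.measurableEmbedding _) (fun x : ℝ => x ^ (a - 1) * (1 - x) ^ (b - 1))
      (Icc (0 : ℝ) 1)
  rw [selbergIntegral_eq_integral_weight]
  simp_rw [weight_one]
  rw [cube_one_eq_preimage]
  exact h.trans (integral_Icc_rpow_mul_one_sub_rpow ha hb)

/-- **Selberg's formula for `n = 1`**: `S₁(a,b,c) = selbergProduct 1 a b c` whenever `a, b > 0` and
`Γ(1 + c) ≠ 0` (e.g. `c > -1`). [cite: ForresterWarnaar2008, eq. (1.1), (1.3)] -/
theorem selbergIntegral_one_eq_selbergProduct {a b c : ℝ} (ha : 0 < a) (hb : 0 < b)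
    (hc : Gamma (1 + c) ≠ 0) : selbergIntegral 1 a b c = selbergProduct 1 a b c := by
  rw [selbergIntegral_one_eq c ha hb, selbergProduct_one a b c hc]

/-! ### Integrability on the cube for `a, b > 0`, `c ≥ 0` -/

/-- Lebesgue measure restricted to the cube is the product of the restricted measures.
[folklore] -/
theorem volume_restrict_cube (n : ℕ) :
    (volume : Measure (Fin n → ℝ)).restrict (cube n) =
      Measure.pi fun _ : Fin n => (volume : Measure ℝ).restrict (Icc (0 : ℝ) 1) := by
  rw [cube, volume_pi, Measure.restrict_pi_pi]

/-- The one-body factor is integrable on the cube for `a, b > 0`. [folklore] -/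
theorem integrableOn_body {n : ℕ} {a b : ℝ} (ha : 0 < a) (hb : 0 < b) :
    IntegrableOn (body n a b) (cube n) := by
  rw [IntegrableOn, volume_restrict_cube]
  exact Integrable.fintype_prod (f := fun (_ : Fin n) (x : ℝ) => x ^ (a - 1) * (1 - x) ^ (b - 1))
    fun _ => integrableOn_Icc_rpow_mul_one_sub_rpow ha hb

/-- The Selberg weight is integrable on the cube for `a, b > 0`, `c ≥ 0` (it is dominated by the
one-body factor). [folklore] -/
theorem integrableOn_weight {n : ℕ} {a b c : ℝ} (ha : 0 < a) (hb : 0 < b) (hc : 0 ≤ c) :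
    IntegrableOn (weight n a b c) (cube n) := by
  refine Integrable.mono' (integrableOn_body ha hb)
    (measurable_weight n a b c).aestronglyMeasurable ?_
  refine ae_restrict_of_forall_mem (measurableSet_cube n) fun t ht => ?_
  rw [Real.norm_eq_abs, abs_of_nonneg (weight_nonneg a b c ht)]
  exact weight_le_body a b hc ht

/-- The Selberg integral is nonnegative (junk value `0` included). [folklore] -/
theorem selbergIntegral_nonneg (n : ℕ) (a b c : ℝ) : 0 ≤ selbergIntegral n a b c := by
  rw [selbergIntegral_eq_integral_weight]
  exact setIntegral_nonneg (measurableSet_cube n) fun t ht => weight_nonneg a b c ht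

/-! ### Permutation symmetry -/

/-- Relabelling coordinates by `σ` is Mathlib's `MeasurableEquiv.piCongrLeft (fun _ => ℝ) σ.symm`:
it sends `t` to `t ∘ σ`. [folklore] -/
theorem piCongrLeft_perm_apply {n : ℕ} (σ : Equiv.Perm (Fin n)) (t : Fin n → ℝ) (i : Fin n) :
    MeasurableEquiv.piCongrLeft (fun _ : Fin n => ℝ) σ.symm t i = t (σ i) := by
  have h := Equiv.piCongrLeft_apply_apply (P := fun _ : Fin n => ℝ) σ.symm t (σ i)
  rw [Equiv.symm_apply_apply] at h
  rw [MeasurableEquiv.coe_piCongrLeft]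
  exact h

/-- Relabelling coordinates by `σ` sends `t` to `t ∘ σ`. [folklore] -/
theorem piCongrLeft_perm_eq {n : ℕ} (σ : Equiv.Perm (Fin n)) (t : Fin n → ℝ) :
    MeasurableEquiv.piCongrLeft (fun _ : Fin n => ℝ) σ.symm t = t ∘ σ :=
  funext fun i => piCongrLeft_perm_apply σ t i

/-- `t ∘ σ` lies in the cube iff `t` does. [folklore] -/
theorem cube_comp_perm_iff {n : ℕ} (σ : Equiv.Perm (Fin n)) (t : Fin n → ℝ) :
    t ∘ σ ∈ cube n ↔ t ∈ cube n := by
  simp only [mem_cube_iff, Function.comp_apply]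
  constructor
  · intro h i; simpa using h (σ.symm i)
  · intro h i; exact h (σ i)

/-- The cube is invariant under relabelling of coordinates. [folklore] -/
theorem preimage_piCongrLeft_cube {n : ℕ} (σ : Equiv.Perm (Fin n)) :
    (MeasurableEquiv.piCongrLeft (fun _ : Fin n => ℝ) σ.symm) ⁻¹' cube n = cube n := by
  ext t
  rw [Set.mem_preimage, piCongrLeft_perm_eq]
  exact cube_comp_perm_iff σ t

/-- `∫_{[0,1]^n} f(t ∘ σ) dt = ∫_{[0,1]^n} f(t) dt` for any permutation `σ` of the coordinates
(no integrability needed; Lebesgue measure is invariant under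
`MeasurableEquiv.piCongrLeft`, `MeasureTheory.volume_measurePreserving_piCongrLeft`). [folklore] -/
theorem integral_cube_comp_perm {n : ℕ} (σ : Equiv.Perm (Fin n)) (f : (Fin n → ℝ) → ℝ) :
    ∫ t in cube n, f (t ∘ σ) = ∫ t in cube n, f t := by
  set e := MeasurableEquiv.piCongrLeft (fun _ : Fin n => ℝ) σ.symm with he
  have hmp : MeasurePreserving e volume volume :=
    volume_measurePreserving_piCongrLeft (fun _ : Fin n => ℝ) σ.symm
  have h := hmp.setIntegral_preimage_emb e.measurableEmbedding f (cube n)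
  rw [preimage_piCongrLeft_cube] at h
  simp_rw [he, piCongrLeft_perm_eq] at h
  exact h

/-- The one-body factor is a symmetric function. [folklore] -/
theorem body_comp_perm {n : ℕ} (σ : Equiv.Perm (Fin n)) (a b : ℝ) (t : Fin n → ℝ) :
    body n a b (t ∘ σ) = body n a b t := by
  unfold body
  exact Equiv.prod_comp σ (fun i => t i ^ (a - 1) * (1 - t i) ^ (b - 1))

/-- The symmetric pair factor is a symmetric function. [folklore] -/
theorem pairSym_comp_perm {n : ℕ} (σ : Equiv.Perm (Fin n)) (c : ℝ) (t : Fin n → ℝ) :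
    pairSym n c (t ∘ σ) = pairSym n c t := by
  unfold pairSym
  simp only [Function.comp_apply]
  have h1 : ∀ i : Fin n, (∏ j, if i = j then (1 : ℝ) else |t (σ i) - t (σ j)| ^ c) =
      ∏ j, if σ i = j then (1 : ℝ) else |t (σ i) - t j| ^ c := by
    intro i
    rw [← Equiv.prod_comp σ (fun j => if σ i = j then (1 : ℝ) else |t (σ i) - t j| ^ c)]
    refine prod_congr rfl fun j _ => ?_
    simp only [σ.injective.eq_iff]
  simp_rw [h1]
  exact Equiv.prod_comp σ (fun i => ∏ j, if i = j then (1 : ℝ) else |t i - t j| ^ c)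

/-- The Selberg weight is a symmetric function of `t₁, …, tₙ`. [folklore] -/
theorem weight_comp_perm {n : ℕ} (σ : Equiv.Perm (Fin n)) (a b c : ℝ) (t : Fin n → ℝ) :
    weight n a b c (t ∘ σ) = weight n a b c t := by
  rw [weight_eq_body_mul_pairSym, weight_eq_body_mul_pairSym, body_comp_perm, pairSym_comp_perm]

end Selberg

end Literature.Analysis.SpecialFunctions

end
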